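import Literature.AnabelianGeometry.SemiGraphs.TemperedReconstructionR3Refutation
import Literature.AnabelianGeometry.SemiGraphs.TemperedReconstructionCor39UpToTwist
import Literature.AnabelianGeometry.SemiGraphs.TemperoidsResProofs
import HarnessLib

/-!
# The 2-cells of [SemiAnbd] Rmk. 2.4.2 act non-trivially on induced outer homomorphisms: kernel form

Mochizuki, *Semi-graphs of anabelioids*, Publ. RIMS **42** (2006), §2 Rmk. 2.4.2 p. 26 (a morphism of
semi-graphs of anabelioids is compatible with the branch maps "up to conjugation") and §3 Prop. 3.6 (iv)
p. 39 / Cor. 3.9 pp. 42–43 ("induces a morphism of temperoids … well-defined up to the evident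
indeterminacies"; Cor. 3.9 (b): the locally open morphism is determined "on underlying semi-graphs").
[cite: MochizukiSemiAnbd2006, Cor 3.9 pp.42-43]

PROOF-ONLY sequel of `TemperedReconstructionR3Refutation.lean` (abc-iut cell, seat abc-iut-w6-d089; no
`def`, no named fact).  There, `InducesOfCompatible` was refuted by comparing the chosen pull-back of the
identity morphism `loopGraphId p` of the estranged loop `𝒢₁` with two admissible families of conjugating
elements.  Here the POSITIVE side of the same computation is recorded, i.e. the kernel form of the cell's
finding d080-F2 / ruling ξ2: for ONE locally open morphism `F = loopGraphId p` and ANY chart `c` of `𝒢₁`,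

* `not_nonempty_chartPullbackWith_iso` — the pull-back functors through `c` glued with `θ_κ`, `θ_κ'`
  (`IwahoriWitness.twistFamily`) are NOT isomorphic when `κ ≢ κ' (mod p)`;
* `exists_inducesWith_not_inducesWith` — some continuous `φ : π₁^temp(𝒢₁) → π₁^temp(𝒢₁)` is induced by
  `F` along `θ_{1+p}` (`Hom.InducesWith`) but NOT along `θ_1`: "induced by `F`" genuinely depends on the
  2-cell datum, so only the existential reading `Hom.InducesUpToTwist` is a property of `F` alone;
* `exists_compat_pair_not_conj` — two continuous endomorphisms `φ, φ'` of `π₁^temp(𝒢₁)`, BOTH compatible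
  with `F` on verticial and on edge homomorphisms (`Hom.CompatV`, `Hom.CompatE`), with `B^temp(φ) ≇ B^temp(φ')`,
  hence (Prop. 3.2) NOT conjugate: a locally open morphism of semi-graphs of anabelioids does not determine
  the induced outer homomorphism of tempered fundamental groups — consistent with print's Cor. 3.9 (b),
  whose uniqueness clause is about underlying semi-graphs only.

Nothing here takes a side on [IUTchIII] Cor. 3.12.
-/

noncomputable section

namespace Literature.AnabelianGeometry.SemiGraphs

namespace IwahoriWitness

open CategoryTheory ProfiniteSemiGraph

variable (p : ℕ) [Fact p.Prime]

/-- **Differently twisted pull-back functors are not isomorphic**: for `κ ≢ κ' (mod p)` the pull-backs of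
`loopGraphId p` through any chart glued with `θ_κ` and `θ_κ'` admit no natural isomorphism (else the finite
tempered covering `twistCov p` would have isomorphic twisted pull-backs, `toZMod_eq_of_hom`).
[cite: MochizukiSemiAnbd2006, Rmk 2.4.2 p.26] -/
theorem not_nonempty_chartPullbackWith_iso (c : TemperedPiChart (loopGraph p)) {κ κ' : IwU p}
    (h : PadicInt.toZMod κ.s ≠ PadicInt.toZMod κ'.s) :
    ¬ Nonempty ((loopGraphId p).chartPullbackWith (twistFamily p κ) c c ≅
      (loopGraphId p).chartPullbackWith (twistFamily p κ') c c) := by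
  rintro ⟨E⟩
  obtain ⟨e⟩ := nonempty_iso_of_chartPullbackWith_iso (loopGraphId p) _ _ c c E
    ⟨twistCov p, twistCov_isTempered p⟩
  exact h (toZMod_eq_of_hom p κ κ' e.hom).symm

/-- The two test families: `θ_1` and `θ_{1+p}` have different residues. [cite: MochizukiSemiAnbd2006, Rmk 2.4.2 p.26] -/
theorem toZMod_one_ne_toZMod_unit :
    PadicInt.toZMod (1 : IwU p).s ≠ PadicInt.toZMod (⟨1⟩ : IwU p).s := by
  simp

/-- **"Induced by `F`" depends on the 2-cells**: through any chart of `𝒢₁` there is a continuous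
`φ : π₁^temp(𝒢₁) → π₁^temp(𝒢₁)` induced by `loopGraphId p` along `θ_{1+p}` but not along `θ_1`.
[cite: MochizukiSemiAnbd2006, Prop 3.6(iv) p.39] -/
theorem exists_inducesWith_not_inducesWith (c : TemperedPiChart (loopGraph p)) :
    ∃ φ : c.G →ₜ* c.G, (loopGraphId p).InducesWith (twistFamily p ⟨1⟩) c c φ ∧
      ¬ (loopGraphId p).InducesWith (twistFamily p 1) c c φ := by
  obtain ⟨φ, hφ, -⟩ := (loopGraphId p).exists_inducedHom_with (twistFamily p ⟨1⟩) c c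
  refine ⟨φ, hφ, fun ⟨j⟩ => ?_⟩
  obtain ⟨i⟩ := hφ
  exact not_nonempty_chartPullbackWith_iso p c (toZMod_one_ne_toZMod_unit p) ⟨j ≪≫ i.symm⟩

/-- … while both `θ_1` and `θ_{1+p}` DO induce some homomorphism (Prop. 3.2), so `InducesUpToTwist` holds
for two non-conjugate classes at once. [cite: MochizukiSemiAnbd2006, Prop 3.6(iv) p.39] -/
theorem exists_inducesUpToTwist_pair (c : TemperedPiChart (loopGraph p)) :
    ∃ φ φ' : c.G →ₜ* c.G, (loopGraphId p).InducesUpToTwist c c φ ∧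
      (loopGraphId p).InducesUpToTwist c c φ' ∧ ¬ Nonempty (BTemp.res φ ≅ BTemp.res φ') := by
  obtain ⟨φ, ⟨i⟩, -⟩ := (loopGraphId p).exists_inducedHom_with (twistFamily p 1) c c
  obtain ⟨φ', ⟨i'⟩, -⟩ := (loopGraphId p).exists_inducedHom_with (twistFamily p ⟨1⟩) c c
  exact ⟨φ, φ', ⟨_, ⟨i⟩⟩, ⟨_, ⟨i'⟩⟩, fun ⟨e⟩ =>
    not_nonempty_chartPullbackWith_iso p c (toZMod_one_ne_toZMod_unit p) ⟨i ≪≫ e ≪≫ i'.symm⟩⟩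

/-- **A locally open morphism does not determine the induced outer homomorphism**: through any chart of
`𝒢₁` there are continuous `φ, φ'`, BOTH compatible with `loopGraphId p` on verticial and on edge
homomorphisms, with `B^temp(φ) ≇ B^temp(φ')` — hence NOT conjugate in `π₁^temp(𝒢₁)` (Prop. 3.2,
`ResIsoResIff_holds`).  The indeterminacy of Rmk. 2.4.2 is non-trivial on induced outer homomorphisms.
[cite: MochizukiSemiAnbd2006, Cor 3.9 pp.42-43] -/
theorem exists_compat_pair_not_conj (c : TemperedPiChart (loopGraph p)) :
    ∃ φ φ' : c.G →ₜ* c.G,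
      ((loopGraphId p).CompatV c c φ ∧ (loopGraphId p).CompatE c c φ) ∧
      ((loopGraphId p).CompatV c c φ' ∧ (loopGraphId p).CompatE c c φ') ∧
      ¬ Nonempty (BTemp.res φ ≅ BTemp.res φ') ∧
      ¬ ∃ g : c.G, ∀ x, g * φ x * g⁻¹ = φ' x := by
  obtain ⟨φ, ⟨i⟩, hV⟩ := (loopGraphId p).exists_inducedHom_with (twistFamily p 1) c c
  obtain ⟨φ', ⟨i'⟩, hV'⟩ := (loopGraphId p).exists_inducedHom_with (twistFamily p ⟨1⟩) c c
  have hE : (loopGraphId p).CompatE c c φ := fun e ψ ψ' hψ hψ' =>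
    (loopGraphId p).conj_of_chartPullbackWith_iso_edge (twistFamily p 1) c c φ ⟨i⟩ e ψ ψ' hψ hψ'
  have hE' : (loopGraphId p).CompatE c c φ' := fun e ψ ψ' hψ hψ' =>
    (loopGraphId p).conj_of_chartPullbackWith_iso_edge (twistFamily p ⟨1⟩) c c φ' ⟨i'⟩ e ψ ψ' hψ hψ'
  have hres : ¬ Nonempty (BTemp.res φ ≅ BTemp.res φ') := fun ⟨e⟩ =>
    not_nonempty_chartPullbackWith_iso p c (toZMod_one_ne_toZMod_unit p) ⟨i ≪≫ e ≪≫ i'.symm⟩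
  refine ⟨φ, φ', ⟨hV, hE⟩, ⟨hV', hE'⟩, hres, fun hg => hres ?_⟩
  haveI := c.secondCountableTopology
  exact (ResIsoResIff_holds c.G c.G c.isTempered c.isTempered φ φ').2 hg

end IwahoriWitness

end Literature.AnabelianGeometry.SemiGraphs

end
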